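import Literature.Topology.FourManifolds.BasinSpherical

/-!
# The cone map between the basins of two Morse data

Topic `Literature/Topology/FourManifolds` (second file of the *structure conjugacy* of two
one-level Morse data on a handlebody, support of `stmt-SmoothPoincare4-15190`; sequel of
`BasinSpherical.lean`).  Everything here is **proved**; no named facts.

Two basin settings `A` (of `(g_A, ξ_A)`) and `B` (of `(g_B, ξ_B)`) on the same manifold `W`, a
map of directions `T` and a map of levels `λ` give the **cone map**

* `BasinSetting.coneMap A B T λ x = B.conePt (T (A.dir x)) (λ (g_A x))` — the point of `B`-level
  `λ (g_A x)` on the `B`-ray of direction `T (A.dir x)`: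

it has level `λ ∘ g_A` (`apply_coneMap`) and direction `T ∘ dir_A` (`dir_coneMap`), maps
`A`-trajectories to `B`-trajectories (`coneMap_levelProj`), is inverted by the cone map of
`(B, A, T', λ')` for inverse data (`coneMap_coneMap`), is smooth where `T`, `λ` are
(`contMDiffAt_coneMap`), and in Milnor's charts at the two minima it is the cone
`w ↦ (√(λ(a₀ + ‖w‖²) - b₀) / rad_B) • T ((rad_A / ‖w‖) • w)` (`coneMap_ofChart`, from
`dir_ofChart_eq_smul`: the direction of a chart point is its radial projection to the small
sphere).  This is the basin part of the diffeomorphism conjugating two Morse structures.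

## References

* J. Milnor, *Lectures on the h-cobordism theorem* (1965), Def. 3.9, Thms. 3.4, 4.1
  (PDF pp. 12–13, 16, 22). [MilnorHCobordism1965]
-/

open scoped Manifold ContDiff Topology
open Set Function Filter Metric

noncomputable section

namespace Literature.Topology.FourManifolds

open Cobordism FourManifolds.Flow

universe u

namespace BasinSetting

variable {n : ℕ} {W : Type u} [TopologicalSpace W] [T2Space W] [SecondCountableTopology W]
  [CompactSpace W] [ChartedSpace (EuclideanHalfSpace (n + 1)) W] [IsManifold (𝓡∂ (n + 1)) ∞ W]
  {g : W → ℝ} {ξ : Π x : W, TangentSpace (𝓡∂ (n + 1)) x} {B : BasinSetting g ξ}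
  {g' : W → ℝ} {ξ' : Π x : W, TangentSpace (𝓡∂ (n + 1)) x} {B' : BasinSetting g' ξ'}

/-! ### The direction of a chart point -/

/-- **The direction of a chart point is its radial projection to the small sphere**:
`dir (ofChart w) = (rad / ‖w‖) • w` for `0 < ‖w‖ < r₀`. [cite: MilnorHCobordism1965, Def. 3.1 (2), Def. 3.9] -/
theorem dir_ofChart_eq_smul {w : EuclideanSpace ℝ (Fin (n + 1))} (hw0 : w ≠ 0) (hw : ‖w‖ < B.r₀) :
    B.dir (B.ofChart w) = (B.rad / ‖w‖) • w := by
  have hwn : 0 < ‖w‖ := norm_pos_iff.2 hw0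
  have hrad := B.rad_pos
  set s : ℝ := B.rad / ‖w‖ with hs
  have hspos : 0 < s := div_pos hrad hwn
  have hnorm : ‖s • w‖ = B.rad := by
    rw [norm_smul, Real.norm_of_nonneg hspos.le, hs, div_mul_cancel₀ _ hwn.ne']
  have hlt : g (B.ofChart w) < B.sph := B.apply_ofChart_lt_sph hw
  have hlt' : g (B.ofChart (s • w)) < B.sph := B.apply_ofChart_lt_sph (B.norm_lt_r₀_of_eq_rad hnorm)
  rcases le_total s 1 with hs1 | hs1
  · -- `ofChart (s • w) = θ (log s, ofChart w)`
    have h1 : B.ofChart (s • w) = B.θ (Real.log s, B.ofChart w) := by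
      rw [← B.ofChart_smul_toChart hlt hspos hs1, B.toChart_ofChart hw.le]
    have hhit : Hits B.θ g B.sphR (B.ofChart w) :=
      ⟨Real.log s, by rw [← h1]; exact (B.apply_ofChart_eq_sphR_iff (B.norm_lt_r₀_of_eq_rad hnorm).le).2 hnorm⟩
    rw [← B.dir_θ (B.not_isMCriticalPt_of_mem_basin (B.ofChart_mem_basin hw)
      (fun h => hw0 (by rw [← B.toChart_ofChart hw.le, h, B.toChart_p₀])) (hlt.trans (B.sph_lt_L.trans B.L_lt_hi)).le)
      hhit (Real.log s), ← h1, B.dir_ofChart hnorm]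
  · -- `ofChart w = θ (log s⁻¹, ofChart (s • w))`
    have hs' : 0 < s⁻¹ := inv_pos.2 hspos
    have hs'1 : s⁻¹ ≤ 1 := inv_le_one_of_one_le₀ hs1
    have h1 : B.ofChart w = B.θ (Real.log s⁻¹, B.ofChart (s • w)) := by
      rw [← B.ofChart_smul_toChart hlt' hs' hs'1, B.toChart_ofChart (B.norm_lt_r₀_of_eq_rad hnorm).le, smul_smul,
        inv_mul_cancel₀ hspos.ne', one_smul]
    rw [h1, B.dir_θ (B.not_isMCriticalPt_ofChart hnorm) ⟨0, by
      rw [B.θ_zero]; exact (B.apply_ofChart_eq_sphR_iff (B.norm_lt_r₀_of_eq_rad hnorm).le).2 hnorm⟩,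
      B.dir_ofChart hnorm]

/-- The direction of a point of the closed sublevel set `{g < sph}` other than `p₀` is the radial
projection of its chart vector. [folklore] -/
theorem dir_eq_smul_toChart {x : W} (hx : g x < B.sph) (hx0 : x ≠ B.p₀) :
    B.dir x = (B.rad / ‖B.toChart x‖) • B.toChart x := by
  have hx' : B.ofChart (B.toChart x) = x := B.ofChart_toChart_of_apply_le hx.le
  have hv0 : B.toChart x ≠ 0 := fun h0 => hx0 (by rw [← hx', h0, B.ofChart_zero])
  have hvr : ‖B.toChart x‖ < B.r₀ := by
    have h1 := B.norm_toChart_sq hx.le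
    have h2 : ‖B.toChart x‖ ^ 2 < B.r₀ ^ 2 := by rw [h1]; unfold sph at hx; linarith
    exact (pow_lt_pow_iff_left₀ (norm_nonneg _) B.r₀_pos.le two_ne_zero).1 h2
  conv_lhs => rw [← hx']
  exact B.dir_ofChart_eq_smul hv0 hvr

/-! ### The cone map -/

variable (B B') in
/-- **The cone map** of two basin settings `B`, `B'` on `W`, a map of directions `T` and a map
of levels `lam`: the point of `B'`-level `lam (g x)` on the `B'`-ray of direction `T (dir_B x)`. [cite: MilnorHCobordism1965, Thms. 3.4, 4.1] -/
def coneMap (T : EuclideanSpace ℝ (Fin (n + 1)) → EuclideanSpace ℝ (Fin (n + 1))) (lam : ℝ → ℝ) (x : W) : W :=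
  B'.conePt (T (B.dir x)) (lam (g x))

variable {T : EuclideanSpace ℝ (Fin (n + 1)) → EuclideanSpace ℝ (Fin (n + 1))} {lam : ℝ → ℝ}

/-- Unfolding `coneMap`. [folklore] -/
theorem coneMap_def (x : W) : B.coneMap B' T lam x = B'.conePt (T (B.dir x)) (lam (g x)) := rfl

/-- **The cone map has level `lam ∘ g`.** [folklore] -/
theorem apply_coneMap {x : W} (hh : Hits B'.θ g' (lam (g x)) (B'.ofChart (T (B.dir x)))) :
    g' (B.coneMap B' T lam x) = lam (g x) := B'.apply_conePt hh

/-- **The cone map has direction `T ∘ dir`.** [folklore] -/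
theorem dir_coneMap {x : W} (hT : ‖T (B.dir x)‖ = B'.rad) : B'.dir (B.coneMap B' T lam x) = T (B.dir x) :=
  B'.dir_conePt hT _

/-- **The cone map sends trajectories to trajectories**: the image of the level point of `x` at
level `ℓ` is the level point at level `lam ℓ` of the image of `x`. [cite: MilnorHCobordism1965, Thm. 3.4] -/
theorem coneMap_levelProj {x : W} (hnc : ¬ IsMCriticalPt (𝓡∂ (n + 1)) g x) (hx : Hits B.θ g B.sphR x)
    {ℓ : ℝ} (hh : Hits B.θ g ℓ x) (hT : ‖T (B.dir x)‖ = B'.rad) (hℓ' : lam ℓ ∈ Icc B'.lo B'.hi)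
    (hh' : Hits B'.θ g' (lam ℓ) (B'.ofChart (T (B.dir x)))) :
    B.coneMap B' T lam (levelProj B.θ g ℓ x) = levelProj B'.θ g' (lam ℓ) (B.coneMap B' T lam x) := by
  rw [coneMap_def, coneMap_def, B.dir_levelProj hnc hx, B.apply_levelProj hh, B'.levelProj_conePt hT _ hℓ' hh']

/-- The cone map is constant in nothing but the trajectory and the level: two points with the
same direction and the same level have the same image. [folklore] -/
theorem coneMap_congr {x x' : W} (hd : B.dir x = B.dir x') (hl : g x = g x') :
    B.coneMap B' T lam x = B.coneMap B' T lam x' := by rw [coneMap_def, coneMap_def, hd, hl]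

/-- **The cone map of inverse data inverts the cone map** at the basin points other than `p₀`
of level `< hi`. [folklore] -/
theorem coneMap_coneMap {T' : EuclideanSpace ℝ (Fin (n + 1)) → EuclideanSpace ℝ (Fin (n + 1))} {lam' : ℝ → ℝ}
    {x : W} (hx : x ∈ B.basin) (hx0 : x ≠ B.p₀) (hxhi : g x < B.hi) (hT : ‖T (B.dir x)‖ = B'.rad)
    (hh' : Hits B'.θ g' (lam (g x)) (B'.ofChart (T (B.dir x)))) (hT' : T' (T (B.dir x)) = B.dir x)
    (hlam' : lam' (lam (g x)) = g x) : B'.coneMap B T' lam' (B.coneMap B' T lam x) = x := by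
  obtain ⟨-, -, h3⟩ := B.exists_eq_conePt_of_mem_basin hx hx0 hxhi
  rw [coneMap_def (B := B'), dir_coneMap hT, apply_coneMap hh', hT', hlam', h3]

/-- **The cone map lands in the basin of `B'`** (image levels `≤ hi'`). [folklore] -/
theorem coneMap_mem_basin {x : W} (hT : ‖T (B.dir x)‖ = B'.rad) (hℓ : lam (g x) ≤ B'.hi)
    (hh' : Hits B'.θ g' (lam (g x)) (B'.ofChart (T (B.dir x)))) : B.coneMap B' T lam x ∈ B'.basin :=
  B'.conePt_mem_basin hT hℓ hh'

/-- **The cone map is smooth** where the direction is smooth and `T`, `lam` are. [cite: MilnorHCobordism1965, Thm. 4.1 (PDF p. 22); proof of Thm. 5.4, Assertion 4 (PDF p. 29)] -/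
theorem contMDiffAt_coneMap {x : W} (hgx : g x ∈ Icc B.lo B.hi) (hnc : ¬ IsMCriticalPt (𝓡∂ (n + 1)) g x)
    (hx : Hits B.θ g B.sphR x)
    (hT : ContDiffAt ℝ ∞ T (B.dir x)) (hlam : ContDiffAt ℝ ∞ lam (g x))
    (hT0 : T (B.dir x) ≠ 0) (hTr : ‖T (B.dir x)‖ < B'.r₀) (hℓ : lam (g x) ∈ Ioo B'.lo B'.hi)
    (hh' : Hits B'.θ g' (lam (g x)) (B'.ofChart (T (B.dir x)))) :
    ContMDiffAt (𝓡∂ (n + 1)) (𝓡∂ (n + 1)) ∞ (B.coneMap B' T lam) x := by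
  have h1 : ContMDiffAt (𝓡∂ (n + 1)) 𝓘(ℝ, EuclideanSpace ℝ (Fin (n + 1))) ∞ (fun x => T (B.dir x)) x :=
    hT.contMDiffAt.comp x (B.contMDiffAt_dir hgx hnc hx)
  have h2 : ContMDiffAt (𝓡∂ (n + 1)) 𝓘(ℝ, ℝ) ∞ (fun x => lam (g x)) x :=
    hlam.contMDiffAt.comp x (B.isMorseFunction.isMorse.contMDiff x)
  have h3 := (B'.contMDiffAt_conePt_prod hT0 hTr hℓ hh').comp x (h1.prodMk h2)
  exact h3

/-- **In the charts at the minima the cone map is a cone**: for `0 < ‖w‖ < r₀` with image level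
in `(g' p₀', sph')`,
`coneMap (ofChart w) = ofChart' ((√(lam (g p₀ + ‖w‖²) - g' p₀') / rad') • T ((rad / ‖w‖) • w))`. [cite: MilnorHCobordism1965, Def. 3.1 (2), proof of Thm. 3.12] -/
theorem coneMap_ofChart {w : EuclideanSpace ℝ (Fin (n + 1))} (hw0 : w ≠ 0) (hw : ‖w‖ < B.r₀)
    (hT : ‖T ((B.rad / ‖w‖) • w)‖ = B'.rad) (hℓ : lam (g B.p₀ + ‖w‖ ^ 2) ∈ Ioo (g' B'.p₀) B'.sph) :
    B.coneMap B' T lam (B.ofChart w) =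
      B'.ofChart ((Real.sqrt (lam (g B.p₀ + ‖w‖ ^ 2) - g' B'.p₀) / B'.rad) • T ((B.rad / ‖w‖) • w)) := by
  rw [coneMap_def, B.dir_ofChart_eq_smul hw0 hw, B.apply_ofChart hw.le, B'.conePt_eq_ofChart_smul hT hℓ]

end BasinSetting

end Literature.Topology.FourManifolds
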